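import Summits.NavierStokesRegularity.FunctionalMining.SaturatingLawSup
import Summits.NavierStokesRegularity.FunctionalMining.TopEigHeatConvex
import Summits.NavierStokesRegularity.FunctionalMining.TopEigDanskin
import Summits.NavierStokesRegularity.FunctionalMining.PressureFunctional
import Summits.NavierStokesRegularity.FunctionalMining.StrainTensorTransport
import Summits.NavierStokesRegularity.FunctionalMining.QuadraticBudgetStatic
import Literature.Analysis.FluidPDE.TorusForceBookkeeping
import HarnessLib

/-!
# FunctionalMining — amplitude scaling for the one-sided spectral rows `ES.lam1.q | T_LD`:
# homogeneity of the static functionals, the law at ONE viscosity, and the arithmetic core of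
# LEMMA K in SCALING form

Search for candidate a priori estimates; no regularity claim. Cell `pub-nsfunc`, census-2 seat
(gen 41), staged as `pub-nsfunc-census-2/lean/lemmaK-B/TopEigScaling.lean` (sha256 8b8b80399d10ef2b)
and filed verbatim by the prove seat (gen 24; declarations byte-identical);
tree-only imports. Refutation BOOKKEEPING for CANDIDATE a priori inequalities; nothing about
regularity; no witness family is exhibited and no row verdict is a kernel theorem by this file.

The one-sided law `SaturatingLawSup F σ γ κ` (`SaturatingLawSup.lean`) bounds every right
derivative value of `s ↦ F(u s)` by the budget `κ ν^{−γ} (2ℰ(u t)) F(u t)^{1+1/σ}` at EVERY viscosity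
`ν > 0`. The no-go seat's LEMMA K (QN4-NOTE §2; SELKILL-NOTE §2 (D2), SELKILL-NOTE-ADD1 §A1.2) kills
the law for the rows `F = Φ_q = ∫(λ₁⁺)^q(S)` at EVERY FIXED `ν > 0` from ONE family of data with a
production floor, bounded budgets and vanishing heat cost, by the AMPLITUDE SCALING `w ↦ a • w`:
the budget scales like `a^{2+q(1+1/σ)}`, the Euler production like `a^{q+1}`, the heat cost like
`a^q`, so for `1 + q/σ > 0` a small amplitude beats every constant `κ` before the member is chosen.
This file supplies the datum-level half of that argument over TREE declarations only:

* §1 homogeneity under `w ↦ a • w`: the top eigen-set and the Danskin directional derivative of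
  `λ₁` are invariant under `A ↦ a • A`, `a > 0` (`TopEig.topEigSet_smul_of_pos`,
  `TopEig.dirTopEig_smul_left_of_pos`); `λ₁(S(a v)) = a λ₁(S(v))` and its real powers for
  divergence-free `v` (`TopEig.torusStrainTopEig_smul`, `TopEig.rpow_torusStrainTopEig_smul`);
  `heatDissipation Φ_q (a v) = a^q · heatDissipation Φ_q v` for `a > 0`
  (`TopEig.heatDissipation_topEigMoment_smul`); the datum pressure `π_{a v} = a² π_v`, its Hessian
  vector, the nonlinear strain vector `N(a v) = a² N(v)` and the transport term
  (`TopEig.pressureOf_smul`, `TopEig.pressVec_const_smul`, `TopEig.nonlinVec_smul`,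
  `TopEig.transport_smul`); the budget `(2ℰ(a v)) Φ_q(a v)^{1+1/σ} = a^{2+q(1+1/σ)} (2ℰ(v)) Φ_q(v)^{1+1/σ}`
  (`TopEig.enstrophy_topEigMoment_budget_smul`);
* §2 the law at ONE viscosity, `SaturatingLawSupAt ν F σ γ κ` (the body of `SaturatingLawSup` with
  `ν` fixed; `saturatingLawSup_iff_forall_at`), and Lemma 0 (⇒) for it
  (`SaturatingLawSupAt.lowerRate_le`: a lower bound of some initial right derivative value along
  every zero-mean classical solution from `u₀` at viscosity `ν` is below the budget at `u₀`; local
  existence `Torus.exists_classicalNS_smooth` and mean conservation);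
* §3 the arithmetic core of LEMMA K in scaling form (`exists_scale_budget_lt_of_family`): an
  exponent gap `θ > 0`, a floor `0 < c ≤ P i`, budgets `0 ≤ b i ≤ B` and heat costs `H i ≤ ε`
  available for every `ε > 0` give, for EVERY real `K` and EVERY `ν > 0`, an amplitude `0 < a ≤ 1`
  and a member `i` with `K a^θ b i + (ν/a) H i < P i` (choose `a` first, then the member).

The door half (the Euler strain tendency `E_{a w} = a² E_w`, heat-maximal selections, the selection
production `𝒫_q(a w; e) = a^{q+1} 𝒫_q(w; e)`, the fixed-viscosity door and the kill of
`SaturatingLawSupAt ν Φ_q σ γ κ` for every `κ` and every `ν > 0`) is the companion staged file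
`TopEigSaturatingKillNu.lean`, which imports the no-go seat's staged `TopEigSaturatingKill.lean`.
[ours, bookkeeping; elementary homogeneity — Constantin 1994 strain formalism for the objects]
-/

noncomputable section

open MeasureTheory Set Filter Topology Finset
open scoped InnerProductSpace RealInnerProductSpace

namespace Summit.NavierStokesRegularity.FunctionalMining

open Literature.Analysis.FunctionSpaces Literature.Analysis.FluidPDE

namespace TopEig

open StrainL4 StrainTensor

variable {d : Type*} [Fintype d] [DecidableEq d]

/-! ## 1. Homogeneity of the static functionals under `w ↦ a • w` -/

/-- The top eigen-set is invariant under positive scaling of the matrix: `topEigSet (a A) = topEigSet A`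
for `a > 0` (`eᵀ(aA)e = a eᵀAe`, `λ₁(aA) = a λ₁(A)`). [folklore] -/
theorem topEigSet_smul_of_pos [Nonempty d] {a : ℝ} (ha : 0 < a) (A : EuclideanSpace ℝ (d × d)) :
    topEigSet (a • A) = topEigSet A := by
  ext e
  simp only [topEigSet, Set.mem_setOf_eq, quad_smul, lam_smul_of_nonneg ha.le]
  constructor
  · rintro ⟨he, hq⟩
    exact ⟨he, mul_left_cancel₀ ha.ne' hq⟩
  · rintro ⟨he, hq⟩
    exact ⟨he, by rw [hq]⟩

/-- The Danskin directional derivative of `λ₁` ignores positive scaling of the base point: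
`μ(aA; M) = μ(A; M)` for `a > 0`. [folklore; Danskin] -/
theorem dirTopEig_smul_left_of_pos [Nonempty d] {a : ℝ} (ha : 0 < a)
    (A M : EuclideanSpace ℝ (d × d)) : dirTopEig (a • A) M = dirTopEig A M := by
  rw [dirTopEig, dirTopEig, topEigSet_smul_of_pos ha]

/-- `λ₁(S(a v))(x) = a λ₁(S(v))(x)` for `a ≥ 0` and `C¹` fields. [folklore] -/
theorem torusStrainTopEig_smul [Nonempty d] {a : ℝ} (ha : 0 ≤ a)
    {v : UnitAddTorus d → EuclideanSpace ℝ d} (hv : Torus.IsContDiff 1 v) (x : UnitAddTorus d) :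
    torusStrainTopEig (a • v) x = a * torusStrainTopEig v x := by
  rw [← lam_strainFlat, ← lam_strainFlat, strainFlat_smul hv a x, lam_smul_of_nonneg ha]

/-- Real powers of `λ₁` along amplitude rays, `λ₁(S(a v))^r = a^r λ₁(S(v))^r` (`a ≥ 0`), for smooth
divergence-free `v` (there `λ₁ ≥ 0`, `lam_strainFlat_nonneg`). [folklore] -/
theorem rpow_torusStrainTopEig_smul [Nonempty d] {a : ℝ} (ha : 0 ≤ a)
    {v : UnitAddTorus d → EuclideanSpace ℝ d} (hv : Torus.IsSmooth v) (hdiv : Torus.IsDivFree v)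
    (r : ℝ) (x : UnitAddTorus d) :
    torusStrainTopEig (a • v) x ^ r = a ^ r * torusStrainTopEig v x ^ r := by
  have hl : 0 ≤ torusStrainTopEig v x := by
    rw [← lam_strainFlat]; exact lam_strainFlat_nonneg hv hdiv x
  rw [torusStrainTopEig_smul ha (hv.isContDiff (by simp)) x, Real.mul_rpow ha hl]

omit [DecidableEq d] in
/-- `Δ(a v) = a Δv` as functions, for smooth `v` (`Torus.laplacian_const_smul'` pointwise).
[folklore] -/
theorem laplacian_smul_of_isSmooth {v : UnitAddTorus d → EuclideanSpace ℝ d} (hv : Torus.IsSmooth v)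
    (a : ℝ) : Torus.laplacian (a • v) = a • Torus.laplacian v := by
  funext x
  rw [Pi.smul_apply, Torus.laplacian_const_smul' hv a x]

/-- **The heat cost of `Φ_q` is `q`-homogeneous**: `heatDissipation Φ_q (a v) = a^q · heatDissipation Φ_q v`
for `a > 0` and smooth `v` (the heat line of `a v` is `a` times the heat line of `v`, and
`Φ_q(a u) = a^q Φ_q(u)`, `torusTopEigMoment_smul`). [ours, bookkeeping] -/
theorem heatDissipation_topEigMoment_smul [Nonempty d] (q : ℝ) {a : ℝ} (ha : 0 < a)
    {v : UnitAddTorus d → EuclideanSpace ℝ d} (hv : Torus.IsSmooth v) :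
    heatDissipation (torusTopEigMoment q) (a • v) =
      a ^ q * heatDissipation (torusTopEigMoment q) v := by
  unfold heatDissipation
  rw [Real.mul_iSup_of_nonneg (Real.rpow_nonneg ha.le q)]
  refine iSup_congr fun t => ?_
  have hline : a • v + (t : ℝ) • Torus.laplacian (a • v) = a • (v + (t : ℝ) • Torus.laplacian v) := by
    rw [laplacian_smul_of_isSmooth hv, smul_comm (t : ℝ) a, smul_add]
  have hsm : Torus.IsSmooth (v + (t : ℝ) • Torus.laplacian v) := hv.add (hv.laplacian.smul _)
  rw [hline, torusTopEigMoment_smul q ha.le hv, torusTopEigMoment_smul q ha.le hsm]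
  ring

/-- `tr((∇(a v))²) = a² tr((∇v)²)` for `C¹` fields. [folklore] -/
theorem gradSqTrace_smul {v : UnitAddTorus d → EuclideanSpace ℝ d} (hv : Torus.IsContDiff 1 v)
    (a : ℝ) (x : UnitAddTorus d) : gradSqTrace (a • v) x = a ^ 2 * gradSqTrace v x := by
  unfold gradSqTrace
  have h : ∀ i, Torus.partialDeriv i (a • v) = a • Torus.partialDeriv i v := fun i =>
    Torus.partialDeriv_const_smul hv a i
  simp_rw [h, Pi.smul_apply, PiLp.smul_apply, smul_eq_mul, Finset.mul_sum]
  exact Finset.sum_congr rfl fun i _ => Finset.sum_congr rfl fun j _ => by ring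

/-- **The datum pressure is quadratic along amplitude rays**: `π_{a v} = a² π_v`
(`pressureOf v = Δ⁻¹(−tr((∇v)²))`, `Torus.invLaplacian_const_smul`). [folklore] -/
theorem pressureOf_smul {v : UnitAddTorus d → EuclideanSpace ℝ d} (hv : Torus.IsSmooth v) (a : ℝ) :
    pressureOf (a • v) = (a ^ 2) • pressureOf v := by
  unfold pressureOf
  have h : (fun x => -gradSqTrace (a • v) x) = (a ^ 2) • fun x => -gradSqTrace v x := by
    funext x
    rw [Pi.smul_apply, gradSqTrace_smul (hv.isContDiff (by simp)), smul_eq_mul, mul_neg]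
  rw [h, Torus.invLaplacian_const_smul _ _ (isSmooth_neg_gradSqTrace hv)]

omit [Fintype d] in
/-- The pressure-Hessian vector is linear in the pressure: `Π(c P) = c Π(P)` for smooth `P`.
[folklore] -/
theorem pressVec_const_smul [Fintype d] {P : UnitAddTorus d → ℝ} (hP : Torus.IsSmooth P) (c : ℝ)
    (y : UnitAddTorus d) : pressVec (c • P) y = c • pressVec P y := by
  ext q
  rw [PiLp.smul_apply, pressVec_apply, pressVec_apply,
    Torus.partialDeriv_const_smul (hP.isContDiff (by simp)) c q.2,
    Torus.partialDeriv_const_smul ((hP.partialDeriv q.2).isContDiff (by simp)) c q.1,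
    Pi.smul_apply]

/-- The nonlinear strain vector is quadratic along amplitude rays: `N(a v) = a² N(v)` for `C¹`
fields. [folklore] -/
theorem nonlinVec_smul {v : UnitAddTorus d → EuclideanSpace ℝ d} (hv : Torus.IsContDiff 1 v)
    (a : ℝ) (y : UnitAddTorus d) : nonlinVec (a • v) y = (a ^ 2) • nonlinVec v y := by
  have h : ∀ i, Torus.partialDeriv i (a • v) = a • Torus.partialDeriv i v := fun i =>
    Torus.partialDeriv_const_smul hv a i
  ext q
  simp only [nonlinVec_apply, PiLp.smul_apply, smul_eq_mul, h, Pi.smul_apply]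
  rw [← mul_div_assoc, mul_add, Finset.mul_sum, Finset.mul_sum]
  congr 1; congr 1 <;> exact Finset.sum_congr rfl fun k _ => by ring

/-- `S(a v) = a S(v)` as functions, for `C¹` fields (`strainFlat_smul` pointwise). [folklore] -/
theorem strainFlat_smul_fun {v : UnitAddTorus d → EuclideanSpace ℝ d} (hv : Torus.IsContDiff 1 v)
    (a : ℝ) : strainFlat (a • v) = a • strainFlat v := by
  funext x
  rw [Pi.smul_apply, strainFlat_smul hv a x]

/-- `∂ₖ S(a v) = a ∂ₖ S(v)` for smooth `v`. [folklore] -/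
theorem partialDeriv_strainFlat_smul {v : UnitAddTorus d → EuclideanSpace ℝ d}
    (hv : Torus.IsSmooth v) (a : ℝ) (k : d) (x : UnitAddTorus d) :
    Torus.partialDeriv k (strainFlat (a • v)) x = a • Torus.partialDeriv k (strainFlat v) x := by
  rw [strainFlat_smul_fun (hv.isContDiff (by simp)),
    Torus.partialDeriv_const_smul ((isSmooth_strainFlat hv).isContDiff (by simp)) a k, Pi.smul_apply]

/-- The transport term is quadratic along amplitude rays:
`Σₖ (a v)ₖ ∂ₖ S(a v) = a² Σₖ vₖ ∂ₖ S(v)` for smooth `v`. [folklore] -/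
theorem transport_smul {v : UnitAddTorus d → EuclideanSpace ℝ d} (hv : Torus.IsSmooth v)
    (a : ℝ) (x : UnitAddTorus d) :
    ∑ k, (a • v) x k • Torus.partialDeriv k (strainFlat (a • v)) x =
      (a ^ 2) • ∑ k, v x k • Torus.partialDeriv k (strainFlat v) x := by
  simp_rw [partialDeriv_strainFlat_smul hv, Pi.smul_apply, PiLp.smul_apply, smul_eq_mul, smul_smul,
    Finset.smul_sum, smul_smul]
  exact Finset.sum_congr rfl fun k _ => by ring_nf

/-- **The budget of the one-sided law is `(2 + q(1+1/σ))`-homogeneous**: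
`(2ℰ(a v)) Φ_q(a v)^{1+1/σ} = a^{2+q(1+1/σ)} · (2ℰ(v)) Φ_q(v)^{1+1/σ}` for `a > 0` and smooth `v`
(`torusEnstrophy_const_smul`, `torusTopEigMoment_smul`). [ours, bookkeeping] -/
theorem enstrophy_topEigMoment_budget_smul [Nonempty d] (q σ : ℝ) {a : ℝ} (ha : 0 < a)
    {v : UnitAddTorus d → EuclideanSpace ℝ d} (hv : Torus.IsSmooth v) :
    2 * torusEnstrophy (a • v) * torusTopEigMoment q (a • v) ^ (1 + σ⁻¹) =
      a ^ (2 + q * (1 + σ⁻¹)) * (2 * torusEnstrophy v * torusTopEigMoment q v ^ (1 + σ⁻¹)) := by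
  rw [torusEnstrophy_const_smul (hv.isContDiff (by simp)) a, torusTopEigMoment_smul q ha.le hv,
    Real.mul_rpow (Real.rpow_nonneg ha.le q) (torusTopEigMoment_nonneg q v), ← Real.rpow_mul ha.le,
    Real.rpow_add ha, Real.rpow_two]
  ring

/-! ### The `−λ₃` mirror (`Ψ_q = ∫((−λ₃)⁺)^q = Φ_q ∘ Neg`, `TopEigHeatCoerciveSymm.lean`) -/

/-- `Ψ_q(a v) = a^q Ψ_q(v)` for `a ≥ 0` and smooth `v` (`Ψ_q(v) = Φ_q(−v)`, `torusTopEigMoment_neg`).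
[ours, bookkeeping] -/
theorem torusNegBotEigMoment_smul [Nonempty d] (q : ℝ) {a : ℝ} (ha : 0 ≤ a)
    {v : UnitAddTorus d → EuclideanSpace ℝ d} (hv : Torus.IsSmooth v) :
    torusNegBotEigMoment q (a • v) = a ^ q * torusNegBotEigMoment q v := by
  rw [← torusTopEigMoment_neg, ← torusTopEigMoment_neg, ← smul_neg, torusTopEigMoment_smul q ha hv.neg]

/-- Real powers of `−λ₃` along amplitude rays, `(−λ₃(a v))^r = a^r (−λ₃(v))^r` (`a ≥ 0`), for smooth
divergence-free `v` (`−λ₃(v) = λ₁(−v)`, `torusStrainTopEig_neg`). [folklore] -/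
theorem rpow_neg_torusStrainBotEig_smul [Nonempty d] {a : ℝ} (ha : 0 ≤ a)
    {v : UnitAddTorus d → EuclideanSpace ℝ d} (hv : Torus.IsSmooth v) (hdiv : Torus.IsDivFree v)
    (r : ℝ) (x : UnitAddTorus d) :
    (-torusStrainBotEig (a • v) x) ^ r = a ^ r * (-torusStrainBotEig v x) ^ r := by
  rw [← torusStrainTopEig_neg, ← torusStrainTopEig_neg, ← smul_neg,
    rpow_torusStrainTopEig_smul ha hv.neg ((torus_isDivFree_neg_iff v).2 hdiv) r x]

/-- **The heat cost of `Ψ_q` is `q`-homogeneous**: `heatDissipation Ψ_q (a v) = a^q · heatDissipation Ψ_q v`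
for `a > 0` and smooth `v` (`heatDissipation_neg` and the `Φ_q` statement at `−v`). [ours, bookkeeping] -/
theorem heatDissipation_negBotEigMoment_smul [Nonempty d] (q : ℝ) {a : ℝ} (ha : 0 < a)
    {v : UnitAddTorus d → EuclideanSpace ℝ d} (hv : Torus.IsSmooth v) :
    heatDissipation (torusNegBotEigMoment q) (a • v) =
      a ^ q * heatDissipation (torusNegBotEigMoment q) v := by
  rw [torusNegBotEigMoment_eq_comp_neg, ← heatDissipation_neg, ← heatDissipation_neg, ← smul_neg,
    heatDissipation_topEigMoment_smul q ha hv.neg]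

/-- **The budget of the `−λ₃` rows is `(2 + q(1+1/σ))`-homogeneous**:
`(2ℰ(a v)) Ψ_q(a v)^{1+1/σ} = a^{2+q(1+1/σ)} · (2ℰ(v)) Ψ_q(v)^{1+1/σ}` for `a > 0` and smooth `v`.
[ours, bookkeeping] -/
theorem enstrophy_negBotEigMoment_budget_smul [Nonempty d] (q σ : ℝ) {a : ℝ} (ha : 0 < a)
    {v : UnitAddTorus d → EuclideanSpace ℝ d} (hv : Torus.IsSmooth v) :
    2 * torusEnstrophy (a • v) * torusNegBotEigMoment q (a • v) ^ (1 + σ⁻¹) =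
      a ^ (2 + q * (1 + σ⁻¹)) * (2 * torusEnstrophy v * torusNegBotEigMoment q v ^ (1 + σ⁻¹)) := by
  rw [torusEnstrophy_const_smul (hv.isContDiff (by simp)) a, torusNegBotEigMoment_smul q ha.le hv,
    Real.mul_rpow (Real.rpow_nonneg ha.le q) (torusNegBotEigMoment_nonneg q v), ← Real.rpow_mul ha.le,
    Real.rpow_add ha, Real.rpow_two]
  ring

end TopEig

/-! ## 2. The one-sided law at ONE viscosity, and Lemma 0 (⇒) for it -/

variable {d : Type*} [Fintype d] [DecidableEq d]

/-- **The one-sided saturating law at ONE viscosity `ν`** (`SaturatingLawSup` with `ν` fixed): on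
`T³`, along every zero-mean classical solution of unforced Navier–Stokes at viscosity `ν` on a slab
`[a, b]`, every right derivative value `R` of `s ↦ F(u s)` within `[a, b]` obeys
`R ≤ κ ν^{−γ} (2ℰ(u t)) F(u t)^{1+1/σ}`. Search for candidate a priori estimates; no regularity claim —
a CANDIDATE inequality recorded as a `Prop`; nothing is asserted. [ours, bookkeeping] -/
def SaturatingLawSupAt (ν : ℝ) (F : (UnitAddTorus d → EuclideanSpace ℝ d) → ℝ) (σ γ κ : ℝ) : Prop :=
  Fintype.card d = 3 → ∀ ⦃a b : ℝ⦄, a < b →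
    ∀ ⦃u : ℝ → UnitAddTorus d → EuclideanSpace ℝ d⦄ ⦃p : ℝ → UnitAddTorus d → ℝ⦄,
      Torus.IsClassicalNSSolutionOn (Icc a b) ν 0 u p →
      (∀ t ∈ Icc a b, Torus.HasZeroMean (u t)) →
      ∀ t ∈ Icc a b, ∀ R : ℝ, HasDerivWithinAt (fun s => F (u s)) R (Icc a b) t →
        R ≤ κ * ν ^ (-γ) * (2 * torusEnstrophy (u t)) * F (u t) ^ (1 + σ⁻¹)

/-- `SaturatingLawSup F σ γ κ` is the conjunction of its fixed-viscosity forms over `ν > 0`.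
[ours, bookkeeping] -/
theorem saturatingLawSup_iff_forall_at {F : (UnitAddTorus d → EuclideanSpace ℝ d) → ℝ} {σ γ κ : ℝ} :
    SaturatingLawSup (d := d) F σ γ κ ↔ ∀ ⦃ν : ℝ⦄, 0 < ν → SaturatingLawSupAt (d := d) ν F σ γ κ :=
  ⟨fun h _ hν hd => h hd hν, fun h hd _ hν => h hν hd⟩

/-- The law at every viscosity gives the law at each one. [ours, bookkeeping] -/
theorem SaturatingLawSup.at {F : (UnitAddTorus d → EuclideanSpace ℝ d) → ℝ} {σ γ κ : ℝ}
    (h : SaturatingLawSup (d := d) F σ γ κ) {ν : ℝ} (hν : 0 < ν) :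
    SaturatingLawSupAt (d := d) ν F σ γ κ :=
  saturatingLawSup_iff_forall_at.1 h hν

/-- A kill at ONE viscosity kills the law: `¬ SaturatingLawSupAt ν F σ γ κ → ¬ SaturatingLawSup F σ γ κ`
(`ν > 0`). Refutation bookkeeping for a CANDIDATE inequality. [ours, bookkeeping] -/
theorem not_saturatingLawSup_of_not_at {F : (UnitAddTorus d → EuclideanSpace ℝ d) → ℝ}
    {σ γ κ ν : ℝ} (hν : 0 < ν) (h : ¬ SaturatingLawSupAt (d := d) ν F σ γ κ) :
    ¬ SaturatingLawSup (d := d) F σ γ κ :=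
  fun hlaw => h (hlaw.at hν)

/-- **Lemma 0 (⇒) for `SaturatingLawSupAt`, general functional.** If the law holds at viscosity
`ν > 0` and, at a smooth divergence-free zero-mean datum `u₀` on `T³`, the number `L` lies below SOME
right derivative value of `s ↦ F(u s)` at the initial time along EVERY zero-mean classical solution
at viscosity `ν` issued from `u₀`, then `L ≤ κ ν^{−γ} (2ℰ u₀) F(u₀)^{1+1/σ}` (local existence,
`Torus.exists_classicalNS_smooth`; mean conservation). The fixed-viscosity form of the no-go seat's
`SaturatingLawSup.lowerRate_le`. [ours; SIEVELD §0 Lemma 0 (⇒), one-sided form, `ν` fixed] -/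
theorem SaturatingLawSupAt.lowerRate_le {F : (UnitAddTorus d → EuclideanSpace ℝ d) → ℝ}
    {σ γ κ ν : ℝ} (h : SaturatingLawSupAt (d := d) ν F σ γ κ) (hd : Fintype.card d = 3) (hν : 0 < ν)
    {u₀ : UnitAddTorus d → EuclideanSpace ℝ d} (hu₀ : Torus.IsSmooth u₀) (hdiv : Torus.IsDivFree u₀)
    (hmean : Torus.HasZeroMean u₀) {L : ℝ}
    (hL : ∀ ⦃T : ℝ⦄, 0 < T →
      ∀ ⦃u : ℝ → UnitAddTorus d → EuclideanSpace ℝ d⦄ ⦃p : ℝ → UnitAddTorus d → ℝ⦄,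
      Torus.IsClassicalNSSolutionOn (Icc 0 T) ν 0 u p → u 0 = u₀ →
      (∀ t ∈ Icc 0 T, Torus.HasZeroMean (u t)) →
      ∃ R : ℝ, HasDerivWithinAt (fun s => F (u s)) R (Icc 0 T) 0 ∧ L ≤ R) :
    L ≤ κ * ν ^ (-γ) * (2 * torusEnstrophy u₀) * F u₀ ^ (1 + σ⁻¹) := by
  obtain ⟨T, hT, u, p, hsol, hu0, -⟩ := Torus.exists_classicalNS_smooth (d := d) hd.le hν.le hu₀ hdiv
  have hmean' : ∀ t ∈ Icc 0 T, Torus.HasZeroMean (u t) := fun t ht =>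
    hsol.hasZeroMean_of_hasZeroMean (convex_Icc 0 T) (left_mem_Icc.2 hT.le) ht
      (by rw [hu0]; exact hmean)
  obtain ⟨R, hR, hLR⟩ := hL hT hsol hu0 hmean'
  have hle := h hd hT hsol hmean' 0 (left_mem_Icc.2 hT.le) R hR
  rw [hu0] at hle
  exact hLR.trans hle

/-! ## 3. LEMMA K, scaling form: the arithmetic core -/

section LemmaKScaling

variable {ι : Type*}

/-- **LEMMA K (scaling form), arithmetic core.** An exponent gap `θ > 0`; a floor `c > 0` with
`c ≤ P i`; budgets `0 ≤ b i ≤ B`; heat costs with `H i ≤ ε` available for every `ε > 0`. Then for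
EVERY real `K` and EVERY `ν > 0` there are an amplitude `0 < a ≤ 1` and a member `i` with
`K a^θ b i + (ν/a) H i < P i`: take `a = min(1, δ^{1/θ})` with `δ = c/(4(|K|B+1))` (so
`|K| B a^θ ≤ |K| B δ < c/4`), THEN `i` with `H i ≤ c a/(4ν)`. Applied with
`θ = 1 + q/σ`, `K = κ ν^{−γ}`, `b i = (2ℰ(w i)) Φ_q(w i)^{1+1/σ}`, `P i = 𝒫_q(w i; e i)`,
`H i = heatDissipation Φ_q (w i)` and the datum `a • w i`, this is the amplitude scaling of the no-go
seat's pen LEMMA K (QN4-NOTE §2) at a FIXED viscosity. [ours, bookkeeping; elementary] -/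
theorem exists_scale_budget_lt_of_family {θ c B K ν : ℝ} (hθ : 0 < θ) (hc : 0 < c) (hν : 0 < ν)
    {b P H : ι → ℝ} (hb0 : ∀ i, 0 ≤ b i) (hbB : ∀ i, b i ≤ B) (hP : ∀ i, c ≤ P i)
    (hH : ∀ ε : ℝ, 0 < ε → ∃ i, H i ≤ ε) :
    ∃ a : ℝ, 0 < a ∧ a ≤ 1 ∧ ∃ i, K * a ^ θ * b i + ν * a⁻¹ * H i < P i := by
  obtain ⟨i₀, -⟩ := hH 1 one_pos
  have hB0 : 0 ≤ B := (hb0 i₀).trans (hbB i₀)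
  have hA0 : 0 ≤ |K| * B := mul_nonneg (abs_nonneg K) hB0
  have hA1 : 0 < 4 * (|K| * B + 1) := by linarith
  obtain ⟨δ, hδ0, hδeq⟩ : ∃ δ : ℝ, 0 < δ ∧ δ * (4 * (|K| * B + 1)) = c :=
    ⟨c / (4 * (|K| * B + 1)), div_pos hc hA1, div_mul_cancel₀ c hA1.ne'⟩
  obtain ⟨a, ha0, ha1, haθ⟩ : ∃ a : ℝ, 0 < a ∧ a ≤ 1 ∧ a ^ θ ≤ δ := by
    refine ⟨min 1 (δ ^ θ⁻¹), lt_min one_pos (Real.rpow_pos_of_pos hδ0 _), min_le_left _ _, ?_⟩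
    calc min 1 (δ ^ θ⁻¹) ^ θ ≤ (δ ^ θ⁻¹) ^ θ :=
          Real.rpow_le_rpow (lt_min one_pos (Real.rpow_pos_of_pos hδ0 _)).le (min_le_right _ _) hθ.le
      _ = δ := by rw [← Real.rpow_mul hδ0.le, inv_mul_cancel₀ hθ.ne', Real.rpow_one]
  obtain ⟨i, hi⟩ := hH (c / 4 * a / ν) (div_pos (mul_pos (by linarith) ha0) hν)
  refine ⟨a, ha0, ha1, i, ?_⟩
  have haθ0 : 0 ≤ a ^ θ := Real.rpow_nonneg ha0.le θ
  have h1 : K * a ^ θ * b i ≤ |K| * B * δ :=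
    calc K * a ^ θ * b i ≤ |K| * a ^ θ * b i :=
          mul_le_mul_of_nonneg_right (mul_le_mul_of_nonneg_right (le_abs_self K) haθ0) (hb0 i)
      _ ≤ |K| * a ^ θ * B := mul_le_mul_of_nonneg_left (hbB i) (mul_nonneg (abs_nonneg K) haθ0)
      _ ≤ |K| * δ * B :=
          mul_le_mul_of_nonneg_right (mul_le_mul_of_nonneg_left haθ (abs_nonneg K)) hB0
      _ = |K| * B * δ := by ring
  have h2 : |K| * B * δ = c / 4 - δ := by linear_combination hδeq / 4
  have h3 : ν * a⁻¹ * H i ≤ c / 4 :=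
    calc ν * a⁻¹ * H i ≤ ν * a⁻¹ * (c / 4 * a / ν) :=
          mul_le_mul_of_nonneg_left hi (mul_nonneg hν.le (inv_nonneg.2 ha0.le))
      _ = c / 4 := by field_simp
  linarith [hP i]

end LemmaKScaling

end Summit.NavierStokesRegularity.FunctionalMining

end
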